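import Literature.NumberTheory.LFunctions.SelbergDelangeCoefficients
import Literature.NumberTheory.LFunctions.SelbergDelangeZetaPow
import Mathlib.Analysis.Calculus.MeanValue
import HarnessLib

/-!
# `ζ(s)^z` as a Dirichlet series, and its local behaviour at `s = 1` (for MV Theorem 7.17)

Support file (PROVED theorems only, no definitions, no named facts) for the proof of
Montgomery–Vaughan, *Multiplicative Number Theory I*, Theorem 7.17
(`Literature.NumberTheory.LFunctions.MontgomeryVaughan2007_thm_7_17`), continuing the tree's
`SelbergDelangeZetaPow.lean` (the branch `zetaPow z s = exp(z · logZeta₁ s) · (s − 1)^{−z}` of `ζ(s)^z`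
on the slit classical region) and `SelbergDelangeCoefficients.lean` (the coefficients `d_z(n)`):

* `zetaPow_eq_LSeries` — on `σ > 1`, `zetaPow z s = ∑ d_z(n) n^{−s}` ((7.56));
* `exists_norm_logZeta₁_le_mul` — `logZeta₁` is Lipschitz at the branch point:
  `‖logZeta₁ s‖ ≤ M₁ ‖s − 1‖` for `‖s − 1‖ ≤ zfrWidth 1 / 4` (Cauchy's estimate and the mean value
  inequality; `logZeta₁ 1 = 0`);
* `exists_norm_exp_mul_logZeta₁_div_sub_one_le` — the local estimate on the Hankel part of the
  contour, "`ζ(s)^z/s = (s − 1)^{−z}(1 + O(|s − 1|))`" (MV p. 178): for `‖z‖ ≤ R`,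
  `‖exp(z · logZeta₁ s)/s − 1‖ ≤ C_R ‖s − 1‖` when `‖s − 1‖ ≤ zfrWidth 1 / 4`.

## References

* [MontgomeryVaughan2007] H. L. Montgomery, R. C. Vaughan, *Multiplicative Number Theory I*,
  CUP 2007, §7.4, (7.56) and the proof of Theorem 7.17 (p. 178).
-/

noncomputable section

open Complex Set Filter Topology Metric

namespace Literature.NumberTheory.LFunctions

namespace SelbergDelange

/-! ### Identification with the Dirichlet series -/

/-- **On `σ > 1`, `ζ(s)^z = ∑ d_z(n) n^{−s}`**: `zetaPow z s = exp(z · eulerLogZeta s) = LSeries d_z s`.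
[cite: MontgomeryVaughan2007, §7.4 (7.56)] -/
theorem zetaPow_eq_LSeries (z : ℂ) {s : ℂ} (hs : 1 < s.re) :
    zetaPow z s = LSeries (zetaPowCoeff z) s := by
  rw [zetaPow_eq_exp_eulerLogZeta z hs, LSeries_zetaPowCoeff_eq_exp z hs]

/-! ### `logZeta₁` is Lipschitz at `s = 1` -/

/-- The closed ball `‖s − 1‖ ≤ zfrWidth 1 / 2` lies in the box `[1 − zfrWidth 1/2, 2] × [−1, 1]`.
[folklore] -/
theorem box_of_norm_sub_one_le {s : ℂ} (hs : ‖s - 1‖ ≤ zfrWidth 1 / 2) :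
    |s.im| ≤ 1 ∧ 1 - zfrWidth 1 / 2 ≤ s.re ∧ s.re ≤ 2 := by
  have hw : zfrWidth 1 < 1 / 2 := zfrWidth_lt_half 1
  have hre : |s.re - 1| ≤ zfrWidth 1 / 2 := by
    have := abs_re_le_norm (s - 1); simp at this; linarith
  have him : |s.im| ≤ zfrWidth 1 / 2 := by
    have := abs_im_le_norm (s - 1); simp at this; linarith
  refine ⟨by linarith, ?_, ?_⟩
  · linarith [(abs_le.1 hre).1]
  · linarith [(abs_le.1 hre).2]

/-- The closed ball `‖s − 1‖ ≤ zfrWidth 1 / 2` lies in the region. [folklore] -/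
theorem closedBall_one_subset_zfrRegion : closedBall (1 : ℂ) (zfrWidth 1 / 2) ⊆ zfrRegion := by
  intro s hs
  rw [mem_closedBall, dist_eq_norm] at hs
  obtain ⟨h1, h2, h3⟩ := box_of_norm_sub_one_le hs
  exact mem_zfrRegion_of_box h1 h2 h3

/-- **`logZeta₁` is Lipschitz at `1`**: there is `M₁` with `‖logZeta₁ s‖ ≤ M₁ ‖s − 1‖` for
`‖s − 1‖ ≤ zfrWidth 1 / 4` (Cauchy's estimate for the derivative on balls of radius `zfrWidth 1 / 4`
inside the ball of radius `zfrWidth 1 / 2`, where `logZeta₁` is bounded, and the mean value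
inequality; `logZeta₁ 1 = 0`). [folklore] -/
theorem exists_norm_logZeta₁_le_mul :
    ∃ M₁ : ℝ, 0 ≤ M₁ ∧ ∀ s : ℂ, ‖s - 1‖ ≤ zfrWidth 1 / 4 → ‖logZeta₁ s‖ ≤ M₁ * ‖s - 1‖ := by
  obtain ⟨M, hM, hbound⟩ := SatheSelberg.exists_norm_logZeta₁_le_near_one
  set r : ℝ := zfrWidth 1 / 4 with hr
  have hr0 : 0 < r := by have := zfrWidth_pos 1; positivity
  refine ⟨M / r, by positivity, fun s hs ↦ ?_⟩
  -- derivative bound on the closed ball of radius `r` about `1`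
  have hderiv : ∀ c ∈ closedBall (1 : ℂ) r, ‖deriv logZeta₁ c‖ ≤ M / r := by
    intro c hc
    have hc' : ‖c - 1‖ ≤ r := by simpa [dist_eq_norm] using hc
    refine norm_deriv_le_of_forall_mem_sphere_norm_le hr0 ?_ ?_
    · refine differentiableOn_logZeta₁.diffContOnCl_ball (U := zfrRegion) fun w hw ↦ ?_
      have hw' : ‖w - c‖ ≤ r := by simpa [dist_eq_norm] using hw
      apply closedBall_one_subset_zfrRegion
      rw [mem_closedBall, dist_eq_norm]
      calc ‖w - 1‖ = ‖(w - c) + (c - 1)‖ := by ring_nf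
        _ ≤ ‖w - c‖ + ‖c - 1‖ := norm_add_le _ _
        _ ≤ r + r := add_le_add hw' hc'
        _ = zfrWidth 1 / 2 := by rw [hr]; ring
    · intro w hw
      have hw' : ‖w - c‖ = r := by simpa [dist_eq_norm] using hw
      have hw1 : ‖w - 1‖ ≤ zfrWidth 1 / 2 := by
        calc ‖w - 1‖ = ‖(w - c) + (c - 1)‖ := by ring_nf
          _ ≤ ‖w - c‖ + ‖c - 1‖ := norm_add_le _ _
          _ ≤ r + r := add_le_add hw'.le hc'
          _ = zfrWidth 1 / 2 := by rw [hr]; ring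
      obtain ⟨h1, h2, h3⟩ := box_of_norm_sub_one_le hw1
      exact hbound w h1 h2 h3
  -- mean value inequality on the convex closed ball
  have hconv : Convex ℝ (closedBall (1 : ℂ) r) := convex_closedBall _ _
  have hdiff : ∀ c ∈ closedBall (1 : ℂ) r, DifferentiableAt ℂ logZeta₁ c := by
    intro c hc
    have hc' : ‖c - 1‖ ≤ r := by simpa [dist_eq_norm] using hc
    refine differentiableOn_logZeta₁.differentiableAt (isOpen_zfrRegion.mem_nhds ?_)
    apply closedBall_one_subset_zfrRegion
    rw [mem_closedBall, dist_eq_norm]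
    linarith
  have hmv := hconv.norm_image_sub_le_of_norm_deriv_le (𝕜 := ℂ) hdiff hderiv
    (mem_closedBall_self hr0.le) (y := s) (by rwa [mem_closedBall, dist_eq_norm])
  rwa [logZeta₁_one, sub_zero] at hmv

/-- `‖e^{w} − 1‖ ≤ ‖w‖ e^{‖w‖}`. [folklore] -/
theorem norm_exp_sub_one_le_mul_exp (w : ℂ) : ‖exp w - 1‖ ≤ ‖w‖ * Real.exp ‖w‖ := by
  simpa using Complex.norm_exp_sub_sum_le_norm_mul_exp w 1

/-- **The local estimate on the Hankel part of the contour**: for every `R` there is `C` with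
`‖exp(z · logZeta₁ s)/s − 1‖ ≤ C ‖s − 1‖` whenever `‖z‖ ≤ R` and `‖s − 1‖ ≤ zfrWidth 1 / 4` — i.e.
"`ζ(s)^z/s = (s − 1)^{−z}(1 + O(|s − 1|))`" (MV p. 178). [cite: MontgomeryVaughan2007, §7.4 p. 178] -/
theorem exists_norm_exp_mul_logZeta₁_div_sub_one_le (R : ℝ) :
    ∃ C : ℝ, 0 ≤ C ∧ ∀ z s : ℂ, ‖z‖ ≤ R → ‖s - 1‖ ≤ zfrWidth 1 / 4 →
      ‖exp (z * logZeta₁ s) / s - 1‖ ≤ C * ‖s - 1‖ := by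
  obtain ⟨M₁, hM₁, hlip⟩ := exists_norm_logZeta₁_le_mul
  have hw : zfrWidth 1 < 1 / 2 := zfrWidth_lt_half 1
  refine ⟨2 * (|R| * M₁ * Real.exp (|R| * M₁)) + 2, by positivity, fun z s hz hs ↦ ?_⟩
  have hR0 : 0 ≤ R := (norm_nonneg z).trans hz
  have hRabs : |R| = R := abs_of_nonneg hR0
  have hs1 : ‖s - 1‖ ≤ 1 / 2 := by linarith [norm_nonneg (s - 1)]
  -- `‖s‖ ≥ 1/2`
  have hs_norm : 1 / 2 ≤ ‖s‖ := by
    have : ‖(1 : ℂ)‖ ≤ ‖s‖ + ‖s - 1‖ := by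
      calc ‖(1 : ℂ)‖ = ‖s - (s - 1)‖ := by ring_nf
        _ ≤ ‖s‖ + ‖s - 1‖ := norm_sub_le _ _
    rw [norm_one] at this
    linarith
  have hs0 : s ≠ 0 := fun h ↦ by rw [h, norm_zero] at hs_norm; linarith
  -- the exponential factor
  set w : ℂ := z * logZeta₁ s with hwdef
  have hwn : ‖w‖ ≤ R * M₁ * ‖s - 1‖ := by
    calc ‖w‖ ≤ ‖z‖ * ‖logZeta₁ s‖ := norm_mul_le _ _
      _ ≤ R * (M₁ * ‖s - 1‖) := mul_le_mul hz (hlip s hs) (norm_nonneg _) hR0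
      _ = R * M₁ * ‖s - 1‖ := by ring
  have hwn' : ‖w‖ ≤ R * M₁ := by
    have : R * M₁ * ‖s - 1‖ ≤ R * M₁ * 1 :=
      mul_le_mul_of_nonneg_left (by linarith) (by positivity)
    linarith
  have hexp : ‖exp w - 1‖ ≤ R * M₁ * Real.exp (R * M₁) * ‖s - 1‖ := by
    calc ‖exp w - 1‖ ≤ ‖w‖ * Real.exp ‖w‖ := norm_exp_sub_one_le_mul_exp w
      _ ≤ (R * M₁ * ‖s - 1‖) * Real.exp (R * M₁) := by
          gcongr
      _ = R * M₁ * Real.exp (R * M₁) * ‖s - 1‖ := by ring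
  -- `exp w / s − 1 = (exp w − 1)/s + (1 − s)/s`
  have hsplit : exp w / s - 1 = (exp w - 1) / s + (1 - s) / s := by
    field_simp
    ring
  rw [hsplit]
  have hinv : ‖s‖⁻¹ ≤ 2 := by
    rw [inv_le_comm₀ (norm_pos_iff.2 hs0) two_pos]; linarith
  calc ‖(exp w - 1) / s + (1 - s) / s‖ ≤ ‖(exp w - 1) / s‖ + ‖(1 - s) / s‖ := norm_add_le _ _
    _ = ‖exp w - 1‖ * ‖s‖⁻¹ + ‖s - 1‖ * ‖s‖⁻¹ := by
        rw [norm_div, norm_div, div_eq_mul_inv, div_eq_mul_inv, norm_sub_rev 1 s]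
    _ ≤ (R * M₁ * Real.exp (R * M₁) * ‖s - 1‖) * 2 + ‖s - 1‖ * 2 := by
        gcongr
    _ = (2 * (|R| * M₁ * Real.exp (|R| * M₁)) + 2) * ‖s - 1‖ := by rw [hRabs]; ring

/-- For `‖z‖ ≤ R` and `0 < m ≤ 1`: `m^{−Re z} ≤ m^{−R}`. [folklore] -/
theorem rpow_neg_re_le_rpow_neg {z : ℂ} {R m : ℝ} (hz : ‖z‖ ≤ R) (hm0 : 0 < m) (hm1 : m ≤ 1) :
    m ^ (-z.re) ≤ m ^ (-R) := by
  have hre : -R ≤ -z.re := by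
    have := (abs_re_le_norm z).trans hz
    linarith [(abs_le.1 this).2, (abs_le.1 this).1]
  exact Real.rpow_le_rpow_of_exponent_ge hm0 hm1 hre

end SelbergDelange

end Literature.NumberTheory.LFunctions
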